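import Mathlib

/-!
# The scheme of idempotents of a monogenic finite free algebra

[cite: StacksProject, Tag 04GG; Tag 00U0; BhattScholze2015 = arXiv:1309.1198v2, §2.2]

For a commutative ring `B` and a monic polynomial `F ∈ B[X]` of degree `d` we construct a
finitely presented `B`-algebra `IdemAlg F` whose `B`-algebra maps to a `B`-algebra `Q`
correspond to the idempotents of `Q[X]/(F)` (`IdemAlg.idem`, `IdemAlg.exists_eq_idem`,
`IdemAlg.idem_injective`).  Since idempotents lift uniquely along nilpotent thickenings,
`IdemAlg F` is formally étale, hence étale over `B` (`IdemAlg.etale`).  This is the affine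
"scheme of idempotents" used to show that local rings with enough sections of étale algebras
are henselian (Stacks 04GG); it is used in
`Literature/RingTheory/Etale/PointedRetractionHenselian.lean` on the way to
Bhatt–Scholze, Theorem 2.3.4.
-/

universe u

namespace Literature.RingTheory.Etale

open Polynomial

noncomputable section

variable {B : Type u} [CommRing B]

/-- The universal polynomial `Σ_{i<d} Tᵢ Xⁱ` of degree `< d` with indeterminate coefficients.
[folklore] -/
def idemUniv (B : Type u) [CommRing B] (d : ℕ) : (MvPolynomial (Fin d) B)[X] :=
  ∑ i : Fin d, C (MvPolynomial.X i) * X ^ (i : ℕ)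

/-- The universal obstruction to idempotency: the remainder of `T² - T` modulo `F`, where
`T = Σ Tᵢ Xⁱ` is the universal polynomial of degree `< deg F`. [cite: StacksProject, Tag 04GG] -/
def idemRel (F : B[X]) : (MvPolynomial (Fin F.natDegree) B)[X] :=
  (idemUniv B F.natDegree * idemUniv B F.natDegree - idemUniv B F.natDegree) %ₘ
    F.map MvPolynomial.C

/-- The ideal of relations defining the scheme of idempotents of `B[X]/(F)`.
[cite: StacksProject, Tag 04GG] -/
def idemIdeal (F : B[X]) : Ideal (MvPolynomial (Fin F.natDegree) B) :=
  Ideal.span (Set.range fun i : Fin F.natDegree => (idemRel F).coeff i)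

/-- The `B`-algebra representing idempotents of `B[X]/(F)` (for `F` monic): its `Q`-points
are the idempotents of `Q[X]/(F)`. [cite: StacksProject, Tag 04GG] -/
abbrev IdemAlg (F : B[X]) : Type u :=
  MvPolynomial (Fin F.natDegree) B ⧸ idemIdeal F

/-- `IdemAlg F` is finitely presented over `B`. [cite: StacksProject, Tag 04GG] -/
instance IdemAlg.finitePresentation (F : B[X]) : Algebra.FinitePresentation B (IdemAlg F) :=
  Algebra.FinitePresentation.quotient (Submodule.fg_span (Set.finite_range _))

variable {Q : Type u} [CommRing Q] [Algebra B Q]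

/-- The polynomial `Σ qᵢ Xⁱ` with prescribed coefficient vector `q`. [folklore] -/
def polyOf {d : ℕ} (q : Fin d → Q) : Q[X] := ∑ i : Fin d, C (q i) * X ^ (i : ℕ)

omit [Algebra B Q] in
/-- Coefficients of `polyOf q` below `d`. [folklore] -/
@[simp] theorem coeff_polyOf {d : ℕ} (q : Fin d → Q) (i : Fin d) : (polyOf q).coeff i = q i := by
  classical
  simp only [polyOf, finsetSum_coeff, coeff_C_mul, coeff_X_pow]
  rw [Finset.sum_eq_single i]
  · simp
  · intro j _ hji
    rw [if_neg (fun h => hji (Fin.ext h.symm)), mul_zero]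
  · intro h; exact absurd (Finset.mem_univ i) h

omit [Algebra B Q] in
/-- Coefficients of `polyOf q` vanish from `d` on. [folklore] -/
theorem coeff_polyOf_of_le {d : ℕ} (q : Fin d → Q) (n : ℕ) (hn : d ≤ n) :
    (polyOf q).coeff n = 0 := by
  classical
  simp only [polyOf, finsetSum_coeff, coeff_C_mul, coeff_X_pow]
  refine Finset.sum_eq_zero fun j _ => ?_
  rw [if_neg (by intro h; exact absurd (h ▸ j.2) (not_lt.mpr hn)), mul_zero]

omit [Algebra B Q] in
/-- `polyOf q` has degree `< d`. [folklore] -/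
theorem degree_polyOf_lt {d : ℕ} (q : Fin d → Q) : (polyOf q).degree < d :=
  (degree_lt_iff_coeff_zero _ _).2 fun n hn => coeff_polyOf_of_le q n hn

omit [Algebra B Q] in
/-- A polynomial of degree `< d` is `polyOf` of its coefficient vector. [folklore] -/
theorem polyOf_coeff {d : ℕ} (p : Q[X]) (hp : p.degree < d) :
    polyOf (fun i : Fin d => p.coeff i) = p := by
  ext n
  by_cases hn : n < d
  · exact coeff_polyOf (fun i : Fin d => p.coeff i) ⟨n, hn⟩
  · rw [coeff_polyOf_of_le _ n (not_lt.mp hn),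
      (degree_lt_iff_coeff_zero _ _).1 hp n (not_lt.mp hn)]

omit [Algebra B Q] in
/-- Two polynomials of degree `< d` with the same low coefficients are equal. [folklore] -/
theorem polyOf_injective {d : ℕ} : Function.Injective (polyOf : (Fin d → Q) → Q[X]) := by
  intro q₁ q₂ h
  funext i
  rw [← coeff_polyOf q₁ i, ← coeff_polyOf q₂ i, h]

/-- The universal polynomial specialises to `polyOf q` under `Tᵢ ↦ qᵢ`. [folklore] -/
theorem map_idemUniv {d : ℕ} (q : Fin d → Q) :
    (idemUniv B d).map (MvPolynomial.aeval q : MvPolynomial (Fin d) B →ₐ[B] Q).toRingHom =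
      polyOf q := by
  simp [idemUniv, polyOf, Polynomial.map_sum, Polynomial.map_mul, Polynomial.map_pow]

/-- The universal relation specialises to the remainder of `t² - t` modulo `F`, where
`t = polyOf q`. [cite: StacksProject, Tag 04GG] -/
theorem map_idemRel {F : B[X]} (hF : F.Monic) (q : Fin F.natDegree → Q) :
    (idemRel F).map (MvPolynomial.aeval q : MvPolynomial (Fin F.natDegree) B →ₐ[B] Q).toRingHom
      = (polyOf q * polyOf q - polyOf q) %ₘ F.map (algebraMap B Q) := by
  rw [idemRel, map_modByMonic _ (hF.map _), Polynomial.map_sub, Polynomial.map_mul,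
    map_idemUniv, Polynomial.map_map]
  congr 2
  ext x
  simp

/-- The solution set of the relations in a `B`-algebra `Q`. [cite: StacksProject, Tag 04GG] -/
def IsSol (F : B[X]) (q : Fin F.natDegree → Q) : Prop :=
  ∀ i : Fin F.natDegree, MvPolynomial.aeval q ((idemRel F).coeff i) = 0

/-- `q` solves the relations iff `polyOf q` is idempotent modulo `F`. [cite: StacksProject, Tag 04GG] -/
theorem isSol_iff_dvd {F : B[X]} (hF : F.Monic) (q : Fin F.natDegree → Q) :
    IsSol F q ↔ F.map (algebraMap B Q) ∣ polyOf q * polyOf q - polyOf q := by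
  rw [← modByMonic_eq_zero_iff_dvd (hF.map _), ← map_idemRel hF]
  have hc : ∀ i : Fin F.natDegree, ((idemRel F).map
      (MvPolynomial.aeval q : MvPolynomial (Fin F.natDegree) B →ₐ[B] Q).toRingHom).coeff i =
      MvPolynomial.aeval q ((idemRel F).coeff i) := fun i => by
    rw [Polynomial.coeff_map]; rfl
  constructor
  · intro h
    nontriviality Q
    have hFd : (F.map (algebraMap B Q)).degree = F.natDegree := by
      rw [degree_eq_natDegree (hF.map (algebraMap B Q)).ne_zero, hF.natDegree_map]
    have hdeg : ((idemRel F).map (MvPolynomial.aeval q :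
        MvPolynomial (Fin F.natDegree) B →ₐ[B] Q).toRingHom).degree < F.natDegree := by
      rw [map_idemRel hF, ← hFd]
      exact degree_modByMonic_lt _ (hF.map _)
    ext n
    by_cases hn : n < F.natDegree
    · rw [coeff_zero, hc ⟨n, hn⟩]; exact h ⟨n, hn⟩
    · rw [coeff_zero]; exact (degree_lt_iff_coeff_zero _ _).1 hdeg n (not_lt.mp hn)
  · intro h i
    rw [← hc, h, coeff_zero]

/-- `q` solves the relations iff the class of `polyOf q` in `Q[X]/(F)` is idempotent.
[cite: StacksProject, Tag 04GG] -/
theorem isSol_iff_isIdempotentElem {F : B[X]} (hF : F.Monic) (q : Fin F.natDegree → Q) :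
    IsSol F q ↔ IsIdempotentElem (AdjoinRoot.mk (F.map (algebraMap B Q)) (polyOf q)) := by
  rw [isSol_iff_dvd hF, IsIdempotentElem, ← map_mul, eq_comm, AdjoinRoot.mk_eq_mk,
    dvd_sub_comm]

omit [Algebra B Q] in
/-- Naturality of `polyOf`. [folklore] -/
theorem polyOf_map {Q' : Type u} [CommRing Q'] {d : ℕ} (φ : Q →+* Q') (q : Fin d → Q) :
    (polyOf q).map φ = polyOf (φ ∘ q) := by
  simp only [polyOf, Polynomial.map_sum, Polynomial.map_mul, Polynomial.map_pow, map_C, map_X,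
    Function.comp_apply]

namespace IdemAlg

variable (F : B[X])

/-- The coordinate vector of a `B`-algebra map out of `IdemAlg F`. [folklore] -/
def coords (g : IdemAlg F →ₐ[B] Q) : Fin F.natDegree → Q :=
  fun i => g (Ideal.Quotient.mk _ (MvPolynomial.X i))

/-- The coordinates of a point solve the relations. [cite: StacksProject, Tag 04GG] -/
theorem isSol_coords (g : IdemAlg F →ₐ[B] Q) : IsSol F (coords F g) := by
  intro i
  have : (MvPolynomial.aeval (coords F g) : MvPolynomial (Fin F.natDegree) B →ₐ[B] Q) =
      g.comp (Ideal.Quotient.mkₐ B (idemIdeal F)) := by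
    refine MvPolynomial.algHom_ext fun j => ?_
    simp [coords]
  have hmem : (idemRel F).coeff i ∈ idemIdeal F := Ideal.subset_span ⟨i, rfl⟩
  rw [this, AlgHom.comp_apply, Ideal.Quotient.mkₐ_eq_mk, Ideal.Quotient.eq_zero_iff_mem.2 hmem,
    map_zero]

variable {F}

/-- The point of `IdemAlg F` with prescribed coordinates solving the relations. [folklore] -/
def ofSol (q : Fin F.natDegree → Q) (hq : IsSol F q) : IdemAlg F →ₐ[B] Q :=
  Ideal.Quotient.liftₐ (idemIdeal F) (MvPolynomial.aeval q) fun a ha => by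
    refine Submodule.span_induction (p := fun a _ => MvPolynomial.aeval q a = 0) ?_ ?_ ?_ ?_ ha
    · rintro _ ⟨i, rfl⟩; exact hq i
    · simp
    · intro x y _ _ hx hy; simp [hx, hy]
    · intro c x _ hx; simp [hx]

/-- Coordinates of `ofSol`. [folklore] -/
@[simp] theorem coords_ofSol (q : Fin F.natDegree → Q) (hq : IsSol F q) :
    coords F (ofSol q hq) = q := by
  funext i
  simp [coords, ofSol]

variable (F) in
/-- A point is determined by its coordinates. [folklore] -/
theorem coords_injective : Function.Injective (coords (Q := Q) F) := by
  intro g₁ g₂ h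
  refine Ideal.Quotient.algHom_ext _ (MvPolynomial.algHom_ext fun i => ?_)
  exact congr_fun h i

/-- `ofSol` of the coordinates recovers the point. [folklore] -/
theorem ofSol_coords (g : IdemAlg F →ₐ[B] Q) : ofSol (coords F g) (isSol_coords F g) = g :=
  coords_injective F (coords_ofSol _ _)

variable (F) in
/-- The idempotent of `Q[X]/(F)` attached to a `Q`-point of `IdemAlg F`.
[cite: StacksProject, Tag 04GG] -/
def idem (g : IdemAlg F →ₐ[B] Q) : AdjoinRoot (F.map (algebraMap B Q)) :=
  AdjoinRoot.mk _ (polyOf (coords F g))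

/-- The attached element is idempotent. [cite: StacksProject, Tag 04GG] -/
theorem isIdempotentElem_idem (hF : F.Monic) (g : IdemAlg F →ₐ[B] Q) :
    IsIdempotentElem (idem F g) :=
  (isSol_iff_isIdempotentElem hF _).1 (isSol_coords F g)

/-- Every idempotent of `Q[X]/(F)` comes from a point. [cite: StacksProject, Tag 04GG] -/
theorem exists_eq_idem (hF : F.Monic) (e : AdjoinRoot (F.map (algebraMap B Q)))
    (he : IsIdempotentElem e) : ∃ g : IdemAlg F →ₐ[B] Q, idem F g = e := by
  rcases subsingleton_or_nontrivial Q with hQ | hQ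
  · haveI : Subsingleton (AdjoinRoot (F.map (algebraMap B Q))) := Module.subsingleton Q _
    exact ⟨ofSol 0 fun i => Subsingleton.elim _ _, Subsingleton.elim _ _⟩
  set p : Q[X] := AdjoinRoot.modByMonicHom (hF.map (algebraMap B Q)) e with hp
  have hpe : AdjoinRoot.mk _ p = e := AdjoinRoot.mk_leftInverse (hF.map _) e
  have hFd : (F.map (algebraMap B Q)).degree = F.natDegree := by
    rw [degree_eq_natDegree (hF.map (algebraMap B Q)).ne_zero, hF.natDegree_map]
  have hdeg : p.degree < F.natDegree := by
    obtain ⟨p', rfl⟩ := AdjoinRoot.mk_surjective e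
    rw [hp, AdjoinRoot.modByMonicHom_mk, ← hFd]
    exact degree_modByMonic_lt _ (hF.map _)
  have hq : IsSol F (fun i : Fin F.natDegree => p.coeff i) := by
    rw [isSol_iff_isIdempotentElem hF, polyOf_coeff p hdeg, hpe]; exact he
  exact ⟨ofSol _ hq, by rw [idem, coords_ofSol, polyOf_coeff p hdeg, hpe]⟩

/-- A point is determined by its idempotent. [cite: StacksProject, Tag 04GG] -/
theorem idem_injective (hF : F.Monic) : Function.Injective (idem (Q := Q) F) := by
  intro g₁ g₂ h
  apply coords_injective F
  apply polyOf_injective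
  nontriviality Q
  rw [idem, idem, AdjoinRoot.mk_eq_mk] at h
  by_contra hne
  refine (hF.map (algebraMap B Q)).not_dvd_of_degree_lt (sub_ne_zero.2 hne) ?_ h
  rw [degree_eq_natDegree (hF.map (algebraMap B Q)).ne_zero, hF.natDegree_map]
  exact lt_of_le_of_lt (degree_sub_le _ _) (max_lt (degree_polyOf_lt _) (degree_polyOf_lt _))

/-- Base change of `Q[X]/(F)` along a `B`-algebra map `φ : Q → Q'`. [folklore] -/
def rootMap {Q' : Type u} [CommRing Q'] [Algebra B Q'] (φ : Q →ₐ[B] Q') :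
    AdjoinRoot (F.map (algebraMap B Q)) →+* AdjoinRoot (F.map (algebraMap B Q')) :=
  AdjoinRoot.lift ((AdjoinRoot.of _).comp φ.toRingHom) (AdjoinRoot.root _) (by
    rw [Polynomial.eval₂_map]
    have : ((AdjoinRoot.of (F.map (algebraMap B Q'))).comp φ.toRingHom).comp (algebraMap B Q) =
        (AdjoinRoot.of (F.map (algebraMap B Q'))).comp (algebraMap B Q') := by
      ext b; simp
    rw [this, ← Polynomial.eval₂_map]
    exact AdjoinRoot.eval₂_root _)

/-- `rootMap` on classes of polynomials. [folklore] -/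
@[simp] theorem rootMap_mk {Q' : Type u} [CommRing Q'] [Algebra B Q'] (φ : Q →ₐ[B] Q')
    (p : Q[X]) : rootMap (F := F) φ (AdjoinRoot.mk _ p) = AdjoinRoot.mk _ (p.map φ.toRingHom) := by
  rw [rootMap, AdjoinRoot.lift_mk, ← Polynomial.eval₂_map, ← AdjoinRoot.aeval_eq, aeval_def,
    AdjoinRoot.algebraMap_eq]

/-- Naturality of coordinates. [folklore] -/
theorem coords_comp {Q' : Type u} [CommRing Q'] [Algebra B Q'] (φ : Q →ₐ[B] Q')
    (g : IdemAlg F →ₐ[B] Q) : coords F (φ.comp g) = φ ∘ coords F g := rfl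

/-- Naturality of the attached idempotent: base change along `φ` matches composition with
`φ`. [cite: StacksProject, Tag 04GG] -/
theorem idem_comp {Q' : Type u} [CommRing Q'] [Algebra B Q'] (φ : Q →ₐ[B] Q')
    (g : IdemAlg F →ₐ[B] Q) : idem F (φ.comp g) = rootMap φ (idem F g) := by
  rw [idem, idem, rootMap_mk, polyOf_map, coords_comp]; rfl

/-- `rootMap` along a surjection is surjective. [folklore] -/
theorem rootMap_surjective {Q' : Type u} [CommRing Q'] [Algebra B Q'] (φ : Q →ₐ[B] Q')
    (hφ : Function.Surjective φ) : Function.Surjective (rootMap (F := F) φ) := by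
  intro y
  obtain ⟨p', rfl⟩ := AdjoinRoot.mk_surjective y
  obtain ⟨p, rfl⟩ := Polynomial.map_surjective φ.toRingHom hφ p'
  exact ⟨AdjoinRoot.mk _ p, rootMap_mk φ p⟩

/-- Along a square-zero surjection `φ`, the kernel of `rootMap φ` is nil (indeed square-zero
elementwise). [folklore] -/
theorem isNilpotent_of_mem_ker_rootMap {Q' : Type u} [CommRing Q'] [Algebra B Q']
    (φ : Q →ₐ[B] Q') (hφ : Function.Surjective φ) (hN : RingHom.ker φ ^ 2 = ⊥)
    (x : AdjoinRoot (F.map (algebraMap B Q))) (hx : x ∈ RingHom.ker (rootMap (F := F) φ)) :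
    IsNilpotent x := by
  obtain ⟨p, rfl⟩ := AdjoinRoot.mk_surjective x
  rw [RingHom.mem_ker, rootMap_mk, AdjoinRoot.mk_eq_zero] at hx
  obtain ⟨h', hh'⟩ := hx
  obtain ⟨h, rfl⟩ := Polynomial.map_surjective φ.toRingHom hφ h'
  -- `p - F h` has coefficients in `ker φ`
  have hFφ : (F.map (algebraMap B Q')) = (F.map (algebraMap B Q)).map φ.toRingHom := by
    rw [Polynomial.map_map]; congr 1; ext b; simp
  set r : Q[X] := p - F.map (algebraMap B Q) * h with hr
  have hrc : ∀ n, r.coeff n ∈ RingHom.ker φ := by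
    intro n
    rw [RingHom.mem_ker]
    have : ((p.map φ.toRingHom).coeff n) = ((F.map (algebraMap B Q')) * h.map φ.toRingHom).coeff n :=
      congrArg (fun s : Q'[X] => s.coeff n) hh'
    rw [hFφ, ← Polynomial.map_mul, Polynomial.coeff_map, Polynomial.coeff_map] at this
    rw [hr, coeff_sub, map_sub, sub_eq_zero]
    exact this
  have hx : AdjoinRoot.mk (F.map (algebraMap B Q)) p = AdjoinRoot.mk _ r := by
    rw [AdjoinRoot.mk_eq_mk, hr]; exact ⟨h, by ring⟩
  refine ⟨2, ?_⟩
  rw [hx, ← map_pow, AdjoinRoot.mk_eq_zero]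
  suffices hr2 : r ^ 2 = 0 by rw [hr2]; exact dvd_zero _
  ext n
  rw [pow_two, coeff_mul, coeff_zero]
  refine Finset.sum_eq_zero fun ij _ => ?_
  have : r.coeff ij.1 * r.coeff ij.2 ∈ RingHom.ker φ ^ 2 := by
    rw [pow_two]; exact Ideal.mul_mem_mul (hrc _) (hrc _)
  rw [hN] at this
  exact (Submodule.mem_bot _).1 this

/-- `IdemAlg F` is formally étale over `B`: idempotents lift uniquely along square-zero
thickenings. [cite: StacksProject, Tag 04GG] -/
theorem formallyEtale (hF : F.Monic) : Algebra.FormallyEtale B (IdemAlg F) := by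
  rw [Algebra.FormallyEtale.iff_comp_bijective]
  intro Q _ _ N hN
  have hsurj : Function.Surjective (Ideal.Quotient.mkₐ B N) := Ideal.Quotient.mkₐ_surjective B N
  have hker : RingHom.ker (Ideal.Quotient.mkₐ B N) ^ 2 = ⊥ := by
    have : RingHom.ker (Ideal.Quotient.mkₐ B N) = N := Ideal.Quotient.mkₐ_ker B N
    rw [this]; exact hN
  have hnil := isNilpotent_of_mem_ker_rootMap (F := F) (Ideal.Quotient.mkₐ B N) hsurj hker
  constructor
  · intro g₁ g₂ h
    apply idem_injective hF
    refine eq_of_isNilpotent_sub_of_isIdempotentElem (isIdempotentElem_idem hF g₁)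
      (isIdempotentElem_idem hF g₂) (hnil _ ?_)
    rw [RingHom.mem_ker, map_sub, sub_eq_zero, ← idem_comp, ← idem_comp]
    exact congrArg (idem F) h
  · intro gbar
    obtain ⟨e, he, hee⟩ := exists_isIdempotentElem_eq_of_ker_isNilpotent
      (rootMap (F := F) (Ideal.Quotient.mkₐ B N)) hnil (idem F gbar)
      (rootMap_surjective _ hsurj _) (isIdempotentElem_idem hF gbar)
    obtain ⟨g, rfl⟩ := exists_eq_idem hF e he
    refine ⟨g, idem_injective hF ?_⟩
    rw [idem_comp, hee]

/-- `IdemAlg F` is étale over `B` for `F` monic. [cite: StacksProject, Tag 04GG] -/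
theorem etale (hF : F.Monic) : Algebra.Etale B (IdemAlg F) :=
  { formallyEtale := formallyEtale hF, finitePresentation := inferInstance }

end IdemAlg

end

end Literature.RingTheory.Etale
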